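import Literature.AnabelianGeometry.EtaleTheta.Discharge.Sec3CuspidalPreSteps

/-!
# [EtTh] Corollary 3.8 (iii), first clause: `Ψ` preserves the non-cuspidal and cuspidal pre-steps
# — DISCHARGED modulo the printed [FrdI] inputs and the Def. 3.1 support axioms

Mochizuki, *The étale theta function and its Frobenioid-theoretic manifestations*, Publ. RIMS **45**
(2009), Cor. 3.8 (iii), PDF p.81 (printed 307) [cite: MochizukiEtTh2009, Cor 3.8 p.81]:
"(iii) Suppose that `Ψ` preserves the base-field-theoretic morphisms, and that `Φ₁`, `Φ₂` are
cuspidally pure. Then `Ψ` preserves the non-cuspidal and cuspidal pre-steps."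

abc-iut cell, layer L2, node `EtTh:Cor3.8(iii)` — the typed statement is abc-iut-L2-t3's
`Cor38_iii h` (`TemperedFrobenioidProps.lean`), over the REAL predicates `PreservesBaseFieldTheoretic`,
`IsCuspidallyPure`, `IsNonCuspidalPreStep`, `IsCuspidalPreStep` and the REAL model-Frobenioid categories
`C_i.category`.  THIS FILE (theorems only) proves `cor38_iii_of : … → Cor38_iii h` for tempered
Frobenioids over the tree vocabulary `treeMonoidVocab`, by transporting the categorical
characterisations of `Sec3CuspidalPreSteps.lean` along the equivalence `Ψ`, MODULO, as explicit
hypotheses: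
* the two [FrdI] inputs the printed proof (p.82) invokes through "[Mzk17], Theorem 3.4, (ii);
  Theorem 4.2, (i)": `Ψ` and `Ψ⁻¹` preserve pre-steps (`hpre`, `hpre'` — L1's PROVED
  `FrdI.thm34ii_of_isOfFSMType` over FSM-type bases), primary pre-steps (`hprim`, `hprim'` — [FrdI]
  Thm 4.2 (i), abc-iut-L1-t14's `Thm42Sub` chain) and morphisms of Frobenius type (`hfrob`, `hfrob'` —
  [FrdI] Thm 3.4 (iii), L1's PROVED `FrdI.thm34iii_morphisms_of_isOfFSMType`), in the one-directional
  shape of L1's `PrimaryStepsTransport.lean`;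
* the Def. 3.1 (i)–(ii) support axioms `hD1`, `hDa`, `hDn`, `hDc` on each side (see
  `Sec3CuspidalPreSteps.lean`; interface finding: not recorded by `RealifiedDivisorMonoids`).
The second clause of (iii) (`Ψ^Φ` preserves (non-)cuspidal elements and primes) needs [FrdI] Thm 4.9
and is not typed in `Cor38_iii`.  Diagrammatic composition; monoids multiplicative.
HONEST FRAMING: refereed pre-IUT material; nothing here bears on [IUTchIII] Cor. 3.12.
-/

namespace Literature.AnabelianGeometry.EtaleTheta

open CategoryTheory Opposite Literature.AlgebraicGeometry.Frobenioids

universe u₀ v₀ u v w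

variable {D₀ : Type u₀} [Category.{v₀} D₀] {T : RealifiedDivisorMonoids (D₀ := D₀) treeMonoidVocab.{w}}
  {D : Type u} [Category.{v} D] {VD : FrdICatStub.{u, v, w} D}

namespace TemperedFrobenioid

/-! ### Composition with isomorphisms (one tempered Frobenioid) -/

section Iso

variable {C : TemperedFrobenioid T D VD}

/-- Pre-steps are stable under pre-composition with an isomorphism, and conversely.
[cite: MochizukiFrdI2008, Thm. 5.2(ii) p.101] -/
theorem isPreStep_iso_comp_iff {A' A B : C.category} (e : A' ⟶ A) [IsIso e] (f : A ⟶ B) :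
    PreFrobenioid.IsPreStep C.toElem (e ≫ f) ↔ PreFrobenioid.IsPreStep C.toElem f := by
  refine ⟨fun h => ?_, fun h => ModelFrobenioid.isPreStep_comp_of_isIso' e h⟩
  have h' := ModelFrobenioid.isPreStep_comp_of_isIso' (inv e) h
  rwa [IsIso.inv_hom_id_assoc] at h'

/-- Pre-steps are stable under post-composition with an isomorphism, and conversely.
[cite: MochizukiFrdI2008, Thm. 5.2(ii) p.101] -/
theorem isPreStep_comp_iso_iff {A B B' : C.category} (f : A ⟶ B) (e : B ⟶ B') [IsIso e] :
    PreFrobenioid.IsPreStep C.toElem (f ≫ e) ↔ PreFrobenioid.IsPreStep C.toElem f := by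
  refine ⟨fun h => ?_, fun h => ModelFrobenioid.isPreStep_comp_of_isIso h e⟩
  have h' := ModelFrobenioid.isPreStep_comp_of_isIso h (inv e)
  rwa [Category.assoc, IsIso.hom_inv_id, Category.comp_id] at h'

/-- `Div(e ≫ f)` versus `Div(f)` for an isomorphism `e`: base-field-theoretic-ness is unchanged
(`Div(f ∘ e) = Base(e)^* Div(f)` and `Φ^{bs-fld}` is a subfunctor). [cite: MochizukiEtTh2009, Def 3.6 p.78] -/
theorem isBaseFieldTheoretic_iso_comp_iff {A' A B : C.category} (e : A' ⟶ A) [IsIso e] (f : A ⟶ B) :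
    C.IsBaseFieldTheoretic (e ≫ f) ↔ C.IsBaseFieldTheoretic f := by
  haveI : IsIso (ModelFrobenioid.baseMap e) := ModelFrobenioid.isIso_baseMap_of_isIso e
  change C.IsBaseFieldTheoreticDiv (ModelFrobenioid.div (e ≫ f)) ↔
    C.IsBaseFieldTheoreticDiv (ModelFrobenioid.div f)
  rw [ModelFrobenioid.div_comp_of_isIso' C.objectwise_isDivisorial e f]
  refine ⟨fun h => ?_, fun h => isBaseFieldTheoreticDiv_pull _ h⟩
  have h' := isBaseFieldTheoreticDiv_pull (inv (ModelFrobenioid.baseMap e)) h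
  rwa [PreFrobenioid.pull_inv_pull_eq] at h'

/-- `Div(f ≫ e) = Div(f)` for an isomorphism `e`: base-field-theoretic-ness is unchanged.
[cite: MochizukiEtTh2009, Def 3.6 p.78] -/
theorem isBaseFieldTheoretic_comp_iso_iff {A B B' : C.category} (f : A ⟶ B) (e : B ⟶ B') [IsIso e] :
    C.IsBaseFieldTheoretic (f ≫ e) ↔ C.IsBaseFieldTheoretic f := by
  change C.IsBaseFieldTheoreticDiv (ModelFrobenioid.div (f ≫ e)) ↔
    C.IsBaseFieldTheoreticDiv (ModelFrobenioid.div f)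
  rw [ModelFrobenioid.div_comp_of_isIso C.objectwise_isDivisorial f e]

/-- A morphism of Frobenius type pre-composed with an isomorphism is of Frobenius type (for the model
Frobenioid: `Div(F ∘ e) = Base(e)^* Div(F) = 0`, base-isomorphism, co-angular).
[cite: MochizukiFrdI2008, Thm. 5.2(ii) p.101] -/
theorem isFrobeniusType_iso_comp {A' A B : C.category} (e : A' ⟶ A) [IsIso e] {F : A ⟶ B}
    (hF : PreFrobenioid.IsFrobeniusType C.toElem F) :
    PreFrobenioid.IsFrobeniusType C.toElem (e ≫ F) := by
  haveI : IsIso (ModelFrobenioid.baseMap e) := ModelFrobenioid.isIso_baseMap_of_isIso e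
  haveI : IsIso (ModelFrobenioid.baseMap F) := hF.2
  refine ⟨⟨ModelFrobenioid.isCoAngular C.objectwise_isGroupLike _, ?_⟩, ?_⟩
  · change ModelFrobenioid.div (e ≫ F) = 1
    rw [ModelFrobenioid.div_comp_of_isIso' C.objectwise_isDivisorial e F,
      show ModelFrobenioid.div F = 1 from hF.1.2, map_one]
  · change IsIso (ModelFrobenioid.baseMap (e ≫ F))
    rw [ModelFrobenioid.baseMap_comp]
    infer_instance

/-- "Some base-field-theoretic pre-step factors through `π`" is unchanged by pre-composing `π` with an
isomorphism. [cite: MochizukiEtTh2009, Cor 3.8 p.82] -/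
theorem exists_bsFld_factor_iso_comp_iff {A' A Z : C.category} (e : A' ⟶ A) [IsIso e] (π : A ⟶ Z) :
    (∃ (B₃ : C.category) (ψ : A' ⟶ B₃) (χ' : Z ⟶ B₃),
        PreFrobenioid.IsPreStep C.toElem ψ ∧ C.IsBaseFieldTheoretic ψ ∧ (e ≫ π) ≫ χ' = ψ) ↔
      ∃ (B₃ : C.category) (ψ : A ⟶ B₃) (χ' : Z ⟶ B₃),
        PreFrobenioid.IsPreStep C.toElem ψ ∧ C.IsBaseFieldTheoretic ψ ∧ π ≫ χ' = ψ := by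
  constructor
  · rintro ⟨B₃, ψ, χ', hψ, hb, h⟩
    refine ⟨B₃, inv e ≫ ψ, χ', (isPreStep_iso_comp_iff _ _).2 hψ,
      (isBaseFieldTheoretic_iso_comp_iff _ _).2 hb, ?_⟩
    rw [← h, Category.assoc, IsIso.inv_hom_id_assoc]
  · rintro ⟨B₃, ψ, χ', hψ, hb, h⟩
    refine ⟨B₃, e ≫ ψ, χ', (isPreStep_iso_comp_iff _ _).2 hψ,
      (isBaseFieldTheoretic_iso_comp_iff _ _).2 hb, ?_⟩
    rw [Category.assoc, h]

/-- "Some base-field-theoretic pre-step factors through `π`" is unchanged by post-composing `π` with an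
isomorphism. [cite: MochizukiEtTh2009, Cor 3.8 p.82] -/
theorem exists_bsFld_factor_comp_iso_iff {A Z Z' : C.category} (π : A ⟶ Z) (e : Z ⟶ Z') [IsIso e] :
    (∃ (B₃ : C.category) (ψ : A ⟶ B₃) (χ' : Z' ⟶ B₃),
        PreFrobenioid.IsPreStep C.toElem ψ ∧ C.IsBaseFieldTheoretic ψ ∧ (π ≫ e) ≫ χ' = ψ) ↔
      ∃ (B₃ : C.category) (ψ : A ⟶ B₃) (χ' : Z ⟶ B₃),
        PreFrobenioid.IsPreStep C.toElem ψ ∧ C.IsBaseFieldTheoretic ψ ∧ π ≫ χ' = ψ := by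
  constructor
  · rintro ⟨B₃, ψ, χ', hψ, hb, h⟩
    exact ⟨B₃, ψ, e ≫ χ', hψ, hb, by rw [← h, Category.assoc]⟩
  · rintro ⟨B₃, ψ, χ', hψ, hb, h⟩
    refine ⟨B₃, ψ, inv e ≫ χ', hψ, hb, ?_⟩
    rw [Category.assoc, IsIso.hom_inv_id_assoc, h]

end Iso

end TemperedFrobenioid

/-! ### Transfer along `Ψ : C₁ ⥲ C₂` -/

section Transfer

variable {D₀' : Type u₀} [Category.{v₀} D₀'] {T' : RealifiedDivisorMonoids (D₀ := D₀') treeMonoidVocab.{w}}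
  {D' : Type u} [Category.{v} D'] {VD' : FrdICatStub.{u, v, w} D'}
  {C₁ : TemperedFrobenioid T D VD} {C₂ : TemperedFrobenioid T' D' VD'} (h : Cor38Hyp C₁ C₂)

open TemperedFrobenioid

set_option backward.isDefEq.respectTransparency false in
/-- `Ψ⁻¹` also preserves the base-field-theoretic morphisms (from `Ψ Ψ⁻¹ f ≅ f`).
[cite: MochizukiEtTh2009, Cor 3.8 p.81] -/
theorem isBaseFieldTheoretic_inverse_map (hbft : PreservesBaseFieldTheoretic h) {A B : C₂.category}
    {f : A ⟶ B} (hf : C₂.IsBaseFieldTheoretic f) : C₁.IsBaseFieldTheoretic (h.Ψ.inverse.map f) := by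
  apply (hbft (h.Ψ.inverse.map f)).2
  rw [Equivalence.fun_inv_map]
  exact (isBaseFieldTheoretic_iso_comp_iff _ _).2 ((isBaseFieldTheoretic_comp_iso_iff _ _).2 hf)

/-- Transfer of "a base-field-theoretic pre-step factors through `π`" along `Ψ`.
[cite: MochizukiEtTh2009, Cor 3.8 p.82] -/
theorem exists_bsFld_factor_map (hbft : PreservesBaseFieldTheoretic h)
    (hpre : ∀ ⦃X Y : C₁.category⦄ (φ : X ⟶ Y),
      PreFrobenioid.IsPreStep C₁.toElem φ → PreFrobenioid.IsPreStep C₂.toElem (h.Ψ.functor.map φ))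
    {A Z : C₁.category} {π : A ⟶ Z}
    (hπ : ∃ (B₃ : C₁.category) (ψ : A ⟶ B₃) (χ' : Z ⟶ B₃),
      PreFrobenioid.IsPreStep C₁.toElem ψ ∧ C₁.IsBaseFieldTheoretic ψ ∧ π ≫ χ' = ψ) :
    ∃ (B₃ : C₂.category) (ψ : h.Ψ.functor.obj A ⟶ B₃) (χ' : h.Ψ.functor.obj Z ⟶ B₃),
      PreFrobenioid.IsPreStep C₂.toElem ψ ∧ C₂.IsBaseFieldTheoretic ψ ∧ h.Ψ.functor.map π ≫ χ' = ψ := by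
  obtain ⟨B₃, ψ, χ', hψ, hb, hfac⟩ := hπ
  exact ⟨h.Ψ.functor.obj B₃, h.Ψ.functor.map ψ, h.Ψ.functor.map χ', hpre ψ hψ, (hbft ψ).1 hb,
    by rw [← Functor.map_comp, hfac]⟩

/-- Transfer of "a base-field-theoretic pre-step factors through `π`" along `Ψ⁻¹`.
[cite: MochizukiEtTh2009, Cor 3.8 p.82] -/
theorem exists_bsFld_factor_inverse_map (hbft : PreservesBaseFieldTheoretic h)
    (hpre' : ∀ ⦃X Y : C₂.category⦄ (φ : X ⟶ Y),
      PreFrobenioid.IsPreStep C₂.toElem φ → PreFrobenioid.IsPreStep C₁.toElem (h.Ψ.inverse.map φ))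
    {A Z : C₂.category} {π : A ⟶ Z}
    (hπ : ∃ (B₃ : C₂.category) (ψ : A ⟶ B₃) (χ' : Z ⟶ B₃),
      PreFrobenioid.IsPreStep C₂.toElem ψ ∧ C₂.IsBaseFieldTheoretic ψ ∧ π ≫ χ' = ψ) :
    ∃ (B₃ : C₁.category) (ψ : h.Ψ.inverse.obj A ⟶ B₃) (χ' : h.Ψ.inverse.obj Z ⟶ B₃),
      PreFrobenioid.IsPreStep C₁.toElem ψ ∧ C₁.IsBaseFieldTheoretic ψ ∧ h.Ψ.inverse.map π ≫ χ' = ψ := by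
  obtain ⟨B₃, ψ, χ', hψ, hb, hfac⟩ := hπ
  exact ⟨h.Ψ.inverse.obj B₃, h.Ψ.inverse.map ψ, h.Ψ.inverse.map χ', hpre' ψ hψ,
    isBaseFieldTheoretic_inverse_map h hbft hb, by rw [← Functor.map_comp, hfac]⟩

set_option backward.isDefEq.respectTransparency false in
/-- The converse transfer: if a base-field-theoretic pre-step factors through `Ψ(π)`, one factors
through `π` (pull back along `Ψ⁻¹` and conjugate by the unit). [cite: MochizukiEtTh2009, Cor 3.8 p.82] -/
theorem exists_bsFld_factor_of_map (hbft : PreservesBaseFieldTheoretic h)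
    (hpre' : ∀ ⦃X Y : C₂.category⦄ (φ : X ⟶ Y),
      PreFrobenioid.IsPreStep C₂.toElem φ → PreFrobenioid.IsPreStep C₁.toElem (h.Ψ.inverse.map φ))
    {A Z : C₁.category} {π : A ⟶ Z}
    (hπ : ∃ (B₃ : C₂.category) (ψ : h.Ψ.functor.obj A ⟶ B₃) (χ' : h.Ψ.functor.obj Z ⟶ B₃),
      PreFrobenioid.IsPreStep C₂.toElem ψ ∧ C₂.IsBaseFieldTheoretic ψ ∧ h.Ψ.functor.map π ≫ χ' = ψ) :
    ∃ (B₃ : C₁.category) (ψ : A ⟶ B₃) (χ' : Z ⟶ B₃),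
      PreFrobenioid.IsPreStep C₁.toElem ψ ∧ C₁.IsBaseFieldTheoretic ψ ∧ π ≫ χ' = ψ := by
  have h1 := exists_bsFld_factor_inverse_map h hbft hpre' hπ
  rw [Equivalence.inv_fun_map] at h1
  exact (exists_bsFld_factor_comp_iso_iff _ _).1 ((exists_bsFld_factor_iso_comp_iff _ _).1 h1)

set_option backward.isDefEq.respectTransparency false in
/-- The converse transfer along `Ψ⁻¹`. [cite: MochizukiEtTh2009, Cor 3.8 p.82] -/
theorem exists_bsFld_factor_of_inverse_map (hbft : PreservesBaseFieldTheoretic h)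
    (hpre : ∀ ⦃X Y : C₁.category⦄ (φ : X ⟶ Y),
      PreFrobenioid.IsPreStep C₁.toElem φ → PreFrobenioid.IsPreStep C₂.toElem (h.Ψ.functor.map φ))
    {A Z : C₂.category} {π : A ⟶ Z}
    (hπ : ∃ (B₃ : C₁.category) (ψ : h.Ψ.inverse.obj A ⟶ B₃) (χ' : h.Ψ.inverse.obj Z ⟶ B₃),
      PreFrobenioid.IsPreStep C₁.toElem ψ ∧ C₁.IsBaseFieldTheoretic ψ ∧ h.Ψ.inverse.map π ≫ χ' = ψ) :
    ∃ (B₃ : C₂.category) (ψ : A ⟶ B₃) (χ' : Z ⟶ B₃),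
      PreFrobenioid.IsPreStep C₂.toElem ψ ∧ C₂.IsBaseFieldTheoretic ψ ∧ π ≫ χ' = ψ := by
  have h1 := exists_bsFld_factor_map h hbft hpre hπ
  rw [Equivalence.fun_inv_map] at h1
  exact (exists_bsFld_factor_comp_iso_iff _ _).1 ((exists_bsFld_factor_iso_comp_iff _ _).1 h1)

set_option backward.isDefEq.respectTransparency false in
/-- **Transfer of the Frobenius-square criterion along `Ψ`** (the categorical form of "`Ψ` preserves the
primary non-cuspidal steps … hence … the non-cuspidal pre-steps", p.82): if every primary pre-step below a
Frobenius-conjugate of `φ` admits a base-field-theoretic factor, the same holds for `Ψ(φ)` — the data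
around `Ψ(φ)` is pulled back along `Ψ⁻¹`. [cite: MochizukiEtTh2009, Cor 3.8 p.82] -/
theorem frobeniusCriterion_map
    (hpre' : ∀ ⦃X Y : C₂.category⦄ (φ : X ⟶ Y),
      PreFrobenioid.IsPreStep C₂.toElem φ → PreFrobenioid.IsPreStep C₁.toElem (h.Ψ.inverse.map φ))
    (hprim' : ∀ ⦃X Y : C₂.category⦄ (φ : X ⟶ Y), PreFrobenioid.IsPrimaryPreStep C₂.toElem φ →
      PreFrobenioid.IsPrimaryPreStep C₁.toElem (h.Ψ.inverse.map φ))
    (hfrob' : ∀ ⦃X Y : C₂.category⦄ (φ : X ⟶ Y), PreFrobenioid.IsFrobeniusType C₂.toElem φ →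
      PreFrobenioid.IsFrobeniusType C₁.toElem (h.Ψ.inverse.map φ))
    (P₁ : ∀ ⦃A Z : C₁.category⦄, (A ⟶ Z) → Prop) (P₂ : ∀ ⦃A Z : C₂.category⦄, (A ⟶ Z) → Prop)
    (hP : ∀ ⦃A Z : C₂.category⦄ (π : A ⟶ Z), P₁ (h.Ψ.inverse.map π) → P₂ π)
    {A B : C₁.category} {φ : A ⟶ B}
    (H : ∀ ⦃A' B'' Z : C₁.category⦄ (Fm : A ⟶ A') (Fm' : B ⟶ B'') (φ' : A' ⟶ B'') (π : A' ⟶ Z)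
        (χ : Z ⟶ B''),
        PreFrobenioid.IsFrobeniusType C₁.toElem Fm → PreFrobenioid.IsFrobeniusType C₁.toElem Fm' →
        PreFrobenioid.IsPreStep C₁.toElem φ' → Fm ≫ φ' = φ ≫ Fm' →
        PreFrobenioid.IsPrimaryPreStep C₁.toElem π → π ≫ χ = φ' → P₁ π) :
    ∀ ⦃A' B'' Z : C₂.category⦄ (Fm : h.Ψ.functor.obj A ⟶ A') (Fm' : h.Ψ.functor.obj B ⟶ B'')
        (φ' : A' ⟶ B'') (π : A' ⟶ Z) (χ : Z ⟶ B''),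
        PreFrobenioid.IsFrobeniusType C₂.toElem Fm → PreFrobenioid.IsFrobeniusType C₂.toElem Fm' →
        PreFrobenioid.IsPreStep C₂.toElem φ' → Fm ≫ φ' = h.Ψ.functor.map φ ≫ Fm' →
        PreFrobenioid.IsPrimaryPreStep C₂.toElem π → π ≫ χ = φ' → P₂ π := by
  intro A' B'' Z Fm Fm' φ' π χ hFm hFm' hφ' hsq hπ hπχ
  apply hP
  refine H (h.Ψ.unit.app A ≫ h.Ψ.inverse.map Fm) (h.Ψ.unit.app B ≫ h.Ψ.inverse.map Fm')
    (h.Ψ.inverse.map φ') (h.Ψ.inverse.map π) (h.Ψ.inverse.map χ)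
    (isFrobeniusType_iso_comp _ (hfrob' Fm hFm)) (isFrobeniusType_iso_comp _ (hfrob' Fm' hFm'))
    (hpre' φ' hφ') ?_ (hprim' π hπ) (by rw [← Functor.map_comp, hπχ])
  have hsq' := congrArg h.Ψ.inverse.map hsq
  rw [Functor.map_comp, Functor.map_comp, Equivalence.inv_fun_map] at hsq'
  rw [Category.assoc, hsq']
  simp

/-- **Transfer of the Frobenius-square criterion along `Ψ⁻¹`**: if the criterion (for a property `P₂`)
holds around `Ψ(φ)`, the corresponding criterion (for `P₁`) holds around `φ` — the data around `φ` is
pushed forward along `Ψ`. [cite: MochizukiEtTh2009, Cor 3.8 p.82] -/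
theorem frobeniusCriterion_of_map
    (hpre : ∀ ⦃X Y : C₁.category⦄ (φ : X ⟶ Y),
      PreFrobenioid.IsPreStep C₁.toElem φ → PreFrobenioid.IsPreStep C₂.toElem (h.Ψ.functor.map φ))
    (hprim : ∀ ⦃X Y : C₁.category⦄ (φ : X ⟶ Y), PreFrobenioid.IsPrimaryPreStep C₁.toElem φ →
      PreFrobenioid.IsPrimaryPreStep C₂.toElem (h.Ψ.functor.map φ))
    (hfrob : ∀ ⦃X Y : C₁.category⦄ (φ : X ⟶ Y), PreFrobenioid.IsFrobeniusType C₁.toElem φ →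
      PreFrobenioid.IsFrobeniusType C₂.toElem (h.Ψ.functor.map φ))
    (P₁ : ∀ ⦃A Z : C₁.category⦄, (A ⟶ Z) → Prop) (P₂ : ∀ ⦃A Z : C₂.category⦄, (A ⟶ Z) → Prop)
    (hP : ∀ ⦃A Z : C₁.category⦄ (π : A ⟶ Z), P₂ (h.Ψ.functor.map π) → P₁ π)
    {A B : C₁.category} {φ : A ⟶ B}
    (H : ∀ ⦃A' B'' Z : C₂.category⦄ (Fm : h.Ψ.functor.obj A ⟶ A') (Fm' : h.Ψ.functor.obj B ⟶ B'')
        (φ' : A' ⟶ B'') (π : A' ⟶ Z) (χ : Z ⟶ B''),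
        PreFrobenioid.IsFrobeniusType C₂.toElem Fm → PreFrobenioid.IsFrobeniusType C₂.toElem Fm' →
        PreFrobenioid.IsPreStep C₂.toElem φ' → Fm ≫ φ' = h.Ψ.functor.map φ ≫ Fm' →
        PreFrobenioid.IsPrimaryPreStep C₂.toElem π → π ≫ χ = φ' → P₂ π) :
    ∀ ⦃A' B'' Z : C₁.category⦄ (Fm : A ⟶ A') (Fm' : B ⟶ B'') (φ' : A' ⟶ B'') (π : A' ⟶ Z)
        (χ : Z ⟶ B''),
        PreFrobenioid.IsFrobeniusType C₁.toElem Fm → PreFrobenioid.IsFrobeniusType C₁.toElem Fm' →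
        PreFrobenioid.IsPreStep C₁.toElem φ' → Fm ≫ φ' = φ ≫ Fm' →
        PreFrobenioid.IsPrimaryPreStep C₁.toElem π → π ≫ χ = φ' → P₁ π := by
  intro A' B'' Z Fm Fm' φ' π χ hFm hFm' hφ' hsq hπ hπχ
  apply hP
  exact H (h.Ψ.functor.map Fm) (h.Ψ.functor.map Fm') (h.Ψ.functor.map φ') (h.Ψ.functor.map π)
    (h.Ψ.functor.map χ) (hfrob Fm hFm) (hfrob Fm' hFm') (hpre φ' hφ')
    (by rw [← Functor.map_comp, hsq, Functor.map_comp]) (hprim π hπ) (by rw [← Functor.map_comp, hπχ])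

set_option backward.isDefEq.respectTransparency false in
/-- **[EtTh] Corollary 3.8 (iii), first clause** ("`Ψ` preserves the non-cuspidal and cuspidal
pre-steps"): abc-iut-L2-t3's typed `Cor38_iii h` HOLDS for tempered Frobenioids over the tree
vocabulary, modulo the [FrdI] inputs of the printed proof — `Ψ`, `Ψ⁻¹` preserve pre-steps [Thm 3.4
(ii)], primary pre-steps [Thm 4.2 (i)] and morphisms of Frobenius type [Thm 3.4 (iii)] — and the
Def. 3.1 support axioms `hD1`/`hDa`/`hDn`/`hDc` on both sides (see the module docstring).  Proof as in
print (p.82): Def 3.6 (v)(a) makes "primary non-cuspidal" categorical (a base-field-theoretic pre-step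
factors through), (v)(b) gives "primary cuspidal", and the factorization/support step is read through
the morphisms of Frobenius type `(d, id, 0, 0)`. [cite: MochizukiEtTh2009, Cor 3.8 p.81] -/
theorem cor38_iii_of
    (hpre : ∀ ⦃X Y : C₁.category⦄ (φ : X ⟶ Y),
      PreFrobenioid.IsPreStep C₁.toElem φ → PreFrobenioid.IsPreStep C₂.toElem (h.Ψ.functor.map φ))
    (hpre' : ∀ ⦃X Y : C₂.category⦄ (φ : X ⟶ Y),
      PreFrobenioid.IsPreStep C₂.toElem φ → PreFrobenioid.IsPreStep C₁.toElem (h.Ψ.inverse.map φ))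
    (hprim : ∀ ⦃X Y : C₁.category⦄ (φ : X ⟶ Y), PreFrobenioid.IsPrimaryPreStep C₁.toElem φ →
      PreFrobenioid.IsPrimaryPreStep C₂.toElem (h.Ψ.functor.map φ))
    (hprim' : ∀ ⦃X Y : C₂.category⦄ (φ : X ⟶ Y), PreFrobenioid.IsPrimaryPreStep C₂.toElem φ →
      PreFrobenioid.IsPrimaryPreStep C₁.toElem (h.Ψ.inverse.map φ))
    (hfrob : ∀ ⦃X Y : C₁.category⦄ (φ : X ⟶ Y), PreFrobenioid.IsFrobeniusType C₁.toElem φ →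
      PreFrobenioid.IsFrobeniusType C₂.toElem (h.Ψ.functor.map φ))
    (hfrob' : ∀ ⦃X Y : C₂.category⦄ (φ : X ⟶ Y), PreFrobenioid.IsFrobeniusType C₂.toElem φ →
      PreFrobenioid.IsFrobeniusType C₁.toElem (h.Ψ.inverse.map φ))
    (hD1₁ : ∀ (A : Dᵒᵖ) (y : C₁.Φ.carrier A), C₁.IsBaseFieldTheoreticDiv y → C₁.IsNonCuspidal y)
    (hDa₁ : ∀ (A : Dᵒᵖ) (x : C₁.Φ.carrier A), C₁.IsNonCuspidal x → C₁.IsCuspidal x → x = 1)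
    (hDn₁ : ∀ (A : Dᵒᵖ) (x : C₁.Φ.carrier A),
      C₁.IsNonCuspidal x ↔ ∀ y : C₁.Φ.carrier A, IsPrimary y → Precsim y x → C₁.IsNonCuspidal y)
    (hDc₁ : ∀ (A : Dᵒᵖ) (x : C₁.Φ.carrier A),
      C₁.IsCuspidal x ↔ ∀ y : C₁.Φ.carrier A, IsPrimary y → Precsim y x → C₁.IsCuspidal y)
    (hD1₂ : ∀ (A : D'ᵒᵖ) (y : C₂.Φ.carrier A), C₂.IsBaseFieldTheoreticDiv y → C₂.IsNonCuspidal y)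
    (hDa₂ : ∀ (A : D'ᵒᵖ) (x : C₂.Φ.carrier A), C₂.IsNonCuspidal x → C₂.IsCuspidal x → x = 1)
    (hDn₂ : ∀ (A : D'ᵒᵖ) (x : C₂.Φ.carrier A),
      C₂.IsNonCuspidal x ↔ ∀ y : C₂.Φ.carrier A, IsPrimary y → Precsim y x → C₂.IsNonCuspidal y)
    (hDc₂ : ∀ (A : D'ᵒᵖ) (x : C₂.Φ.carrier A),
      C₂.IsCuspidal x ↔ ∀ y : C₂.Φ.carrier A, IsPrimary y → Precsim y x → C₂.IsCuspidal y) :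
    Cor38_iii h := by
  intro hbft hp₁ hp₂ A B f
  -- "a base-field-theoretic pre-step factors through `π`", on each side
  let P₁ : ∀ ⦃A Z : C₁.category⦄, (A ⟶ Z) → Prop := fun A Z π =>
    ∃ (B₃ : C₁.category) (ψ : A ⟶ B₃) (χ' : Z ⟶ B₃),
      PreFrobenioid.IsPreStep C₁.toElem ψ ∧ C₁.IsBaseFieldTheoretic ψ ∧ π ≫ χ' = ψ
  let P₂ : ∀ ⦃A Z : C₂.category⦄, (A ⟶ Z) → Prop := fun A Z π =>
    ∃ (B₃ : C₂.category) (ψ : A ⟶ B₃) (χ' : Z ⟶ B₃),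
      PreFrobenioid.IsPreStep C₂.toElem ψ ∧ C₂.IsBaseFieldTheoretic ψ ∧ π ≫ χ' = ψ
  have hP : ∀ ⦃A Z : C₂.category⦄ (π : A ⟶ Z), P₁ (h.Ψ.inverse.map π) → P₂ π :=
    fun A Z π hπ => exists_bsFld_factor_of_inverse_map h hbft hpre hπ
  have hP' : ∀ ⦃A Z : C₁.category⦄ (π : A ⟶ Z), P₂ (h.Ψ.functor.map π) → P₁ π :=
    fun A Z π hπ => exists_bsFld_factor_of_map h hbft hpre' hπ
  have hQ : ∀ ⦃A Z : C₂.category⦄ (π : A ⟶ Z), ¬ P₁ (h.Ψ.inverse.map π) → ¬ P₂ π :=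
    fun A Z π hπ hπ' => hπ (exists_bsFld_factor_inverse_map h hbft hpre' hπ')
  have hQ' : ∀ ⦃A Z : C₁.category⦄ (π : A ⟶ Z), ¬ P₂ (h.Ψ.functor.map π) → ¬ P₁ π :=
    fun A Z π hπ hπ' => hπ (exists_bsFld_factor_map h hbft hpre hπ')
  -- `f` is a pre-step iff `Ψ f` is
  have hps : PreFrobenioid.IsPreStep C₁.toElem f ↔
      PreFrobenioid.IsPreStep C₂.toElem (h.Ψ.functor.map f) := by
    refine ⟨hpre f, fun h2 => ?_⟩
    have h1 := hpre' _ h2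
    rw [Equivalence.inv_fun_map] at h1
    exact (isPreStep_comp_iso_iff _ _).1 ((isPreStep_iso_comp_iff _ _).1 h1)
  refine ⟨⟨?_, ?_⟩, ⟨?_, ?_⟩⟩
  · rintro ⟨hf, hn⟩
    exact ⟨hpre f hf, (isNonCuspidal_div_iff_frobenius hp₂ hD1₂ hDn₂ (hpre f hf)).2
      (frobeniusCriterion_map h hpre' hprim' hfrob' P₁ P₂ hP
        ((isNonCuspidal_div_iff_frobenius hp₁ hD1₁ hDn₁ hf).1 hn))⟩
  · rintro ⟨hf₂, hn₂⟩
    have hf := hps.2 hf₂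
    exact ⟨hf, (isNonCuspidal_div_iff_frobenius hp₁ hD1₁ hDn₁ hf).2
      (frobeniusCriterion_of_map h hpre hprim hfrob P₁ P₂ hP'
        ((isNonCuspidal_div_iff_frobenius hp₂ hD1₂ hDn₂ hf₂).1 hn₂))⟩
  · rintro ⟨hf, hc⟩
    exact ⟨hpre f hf, (isCuspidal_div_iff_frobenius hp₂ hD1₂ hDa₂ hDn₂ hDc₂ (hpre f hf)).2
      (frobeniusCriterion_map h hpre' hprim' hfrob' (fun A Z π => ¬ P₁ π) (fun A Z π => ¬ P₂ π) hQ
        ((isCuspidal_div_iff_frobenius hp₁ hD1₁ hDa₁ hDn₁ hDc₁ hf).1 hc))⟩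
  · rintro ⟨hf₂, hc₂⟩
    have hf := hps.2 hf₂
    exact ⟨hf, (isCuspidal_div_iff_frobenius hp₁ hD1₁ hDa₁ hDn₁ hDc₁ hf).2
      (frobeniusCriterion_of_map h hpre hprim hfrob (fun A Z π => ¬ P₁ π) (fun A Z π => ¬ P₂ π) hQ'
        ((isCuspidal_div_iff_frobenius hp₂ hD1₂ hDa₂ hDn₂ hDc₂ hf₂).1 hc₂))⟩


end Transfer

end Literature.AnabelianGeometry.EtaleTheta
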